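import Literature.Probability.LatticeModels.DobrushinMetricStates
import HarnessLib

/-!
# Dobrushin's comparison and covariance estimates with a SUPERSOLUTION (Lyapunov vector) in place of the
# row-sum profile

HONEST FRAMING: venture file of the cell `pub-ymgap` (QuantumFields programme), track ROBUST-BALL, seat rb-p2 (g10).
GENERIC lemmas about Dobrushin's comparison argument in the Vasserstein (Kantorovich–Rubinstein) form of the tree
(`Literature/Probability/LatticeModels/DobrushinComparisonMetric.lean`, `…/DobrushinMetricStates.lean`, Föllmer 1988 Ch. I).
Nothing here is specific to gauge theories; nothing about the continuum, a mass gap, or Clay.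

WHAT IS NEW.  The tree's comparison estimate `abs_sub_le_sum_pow_profile` and covariance estimate
`abs_covariance_le_of_isKRContraction` bound the influence of the frozen set `V ∖ W` at a site `y` by `R · c ^ ℓ(y)`,
`c` the ROW SUM of Dobrushin's matrix and `ℓ` a profile that is `1`-Lipschitz along the support of `C` — in effect the
bound `(#paths of length k) ≤ (row sum / entry)^k`, which loses the branching number of the interaction graph in the
decay RATE.  Föllmer's matrix form of the same theorem (LNM 1362, Ch. I, Comparison Theorem (2.8): `|μ f − ν f| ≤ ∑ (bD)_i δ_i(f)`
with `D = ∑_n C^n`) is sharper: `D 𝟙_{V∖W} ≤ v` for EVERY nonnegative vector `v` with `v ≥ 1` on `V ∖ W` and `(Cv)_y ≤ v_y` on `W`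
(a SUPERSOLUTION of the linear recursion; discrete maximum principle).  We prove exactly this consequence inside the tree's
iteration scheme: the iterates `Φ^n R` of the constant estimate satisfy `Φ^n R ≤ R (min 1 v + c^n)` (`iterate_phi_le_of_supersolution`),
whence `|E₁ f − E₂ f| ≤ R ∑_{y ∈ Δ} (min 1 v(y) + c^n) δ(y)` for every `n` (`abs_sub_le_of_supersolution`) and the covariance
estimate `|cov_μ(f,g)| ≤ 2R² (∑ δ_g) ∑_{y ∈ Δ_f} (min 1 v(y) + c^n) δ_f(y)` for a Gibbs measure of a specification satisfying
Dobrushin's condition, for every supersolution `v` relative to the support `Δ_g` (`abs_covariance_le_of_supersolution`,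
`…_of_lt_one` without the `c^n` term when `c < 1`).  The row-sum profile is the special case `v = c^ℓ`.  The point of the
generalisation: on a lattice, an ANISOTROPIC supersolution concentrated along one axis decays at the rate of the single matrix
ENTRY (unique geodesic) rather than of the row sum (sibling files `SlabAxisProfile`, `SlabAxisDecay`).

References: H. Föllmer, Random fields and diffusion processes, LNM 1362 (1988), Ch. I, Lemma (2.5), Thm (2.8), Thm (2.13);
H. Künsch, Decay of correlations under Dobrushin's uniqueness condition, CMP 84 (1982) 207–222 (matrix form of the covariance bound).
-/

noncomputable section

open MeasureTheory ProbabilityTheory Finset Function Filter Topology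
open Literature.Probability.LatticeModels Literature.Probability.LatticeModels.DobrushinMetric

namespace Summit.Ventures.YMGap.RobustBall.DobrushinSupersolution

variable {V S : Type*} [DecidableEq V]

/-! ### Abstract part: iterates of the constant estimate under a supersolution -/

section Abstract

variable (D : DustingData V S)

/-- `rowC` is additive in the vector. [folklore] -/
theorem rowC_add (a b : V → ℝ) (x : V) : D.rowC (fun y => a y + b y) x = D.rowC a x + D.rowC b x := by
  simp only [DustingData.rowC, mul_add, Finset.sum_add_distrib]

/-- The iterates of the sweep leave the values off `W` unchanged: `(Φ^n a) y = a y` for `y ∉ W`. [folklore] -/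
theorem iterate_phi_apply_of_not_mem (a : V → ℝ) {y : V} (hy : y ∉ D.W) (n : ℕ) : (D.phi^[n] a) y = a y := by
  induction n with
  | zero => rfl
  | succ n ih => rw [Function.iterate_succ_apply', D.phi_apply_of_not_mem hy, ih]

/-- **Iterates under a supersolution** (discrete maximum principle for Föllmer's matrix `D = ∑ Cⁿ`, LNM 1362 Ch. I (2.8)):
if the rows of `C` sum to at most `c ≤ 1` on `W` and `v ≥ 0` satisfies `v ≥ 1` off `W` and `(C v)_y ≤ v_y` on `W`, then
`(Φ^n R)_y ≤ R · (min 1 v(y) + c^n)` for every `n` and `y`.  Proof: induction on `n`; on `W`,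
`C (min 1 v + c^n) ≤ min (C 1) (C v) + c^n C 1 ≤ min c v + c^{n+1} ≤ min 1 v + c^{n+1}`; off `W` both sides are `≥ R`.
[cite: Follmer1988, Ch. I Comparison Theorem (2.8)] -/
theorem iterate_phi_le_of_supersolution {c : ℝ} (hc0 : 0 ≤ c) (hc1 : c ≤ 1)
    (hrow : ∀ x ∈ D.W, ∑ y ∈ D.nbr x, D.C x y ≤ c) {v : V → ℝ} (hv0 : ∀ y, 0 ≤ v y)
    (hv1 : ∀ y ∉ D.W, 1 ≤ v y) (hv : ∀ y ∈ D.W, D.rowC v y ≤ v y) (n : ℕ) (y : V) :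
    (D.phi^[n] fun _ => D.R) y ≤ D.R * (min 1 (v y) + c ^ n) := by
  induction n generalizing y with
  | zero =>
    simp only [Function.iterate_zero, id_eq, pow_zero]
    have h : 0 ≤ min 1 (v y) := le_min zero_le_one (hv0 y)
    nlinarith [D.R_nonneg]
  | succ n ih =>
    rw [Function.iterate_succ_apply']
    by_cases hy : y ∈ D.W
    · rw [D.phi_apply_of_mem hy, DustingData.rowC]
      -- bound each term by the induction hypothesis
      have h1 : ∑ z ∈ D.nbr y, D.C y z * (D.phi^[n] fun _ => D.R) z ≤
          ∑ z ∈ D.nbr y, D.C y z * (D.R * (min 1 (v z) + c ^ n)) :=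
        Finset.sum_le_sum fun z _ => mul_le_mul_of_nonneg_left (ih z) (D.C_nonneg y z)
      refine h1.trans ?_
      -- `C (min 1 v) ≤ min (C 1) (C v) ≤ min c (v y)` and `C 1 ≤ c`
      have hmin1 : ∑ z ∈ D.nbr y, D.C y z * min 1 (v z) ≤ c :=
        calc ∑ z ∈ D.nbr y, D.C y z * min 1 (v z) ≤ ∑ z ∈ D.nbr y, D.C y z * 1 :=
              Finset.sum_le_sum fun z _ => mul_le_mul_of_nonneg_left (min_le_left _ _) (D.C_nonneg y z)
          _ ≤ c := by simpa using hrow y hy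
      have hminv : ∑ z ∈ D.nbr y, D.C y z * min 1 (v z) ≤ v y :=
        calc ∑ z ∈ D.nbr y, D.C y z * min 1 (v z) ≤ ∑ z ∈ D.nbr y, D.C y z * v z :=
              Finset.sum_le_sum fun z _ => mul_le_mul_of_nonneg_left (min_le_right _ _) (D.C_nonneg y z)
          _ ≤ v y := hv y hy
      have hmin : ∑ z ∈ D.nbr y, D.C y z * min 1 (v z) ≤ min 1 (v y) :=
        le_min (hmin1.trans hc1) hminv
      have hpow : ∑ z ∈ D.nbr y, D.C y z * c ^ n ≤ c ^ (n + 1) := by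
        rw [← Finset.sum_mul, pow_succ']
        exact mul_le_mul_of_nonneg_right (hrow y hy) (pow_nonneg hc0 n)
      have hsplit : ∑ z ∈ D.nbr y, D.C y z * (D.R * (min 1 (v z) + c ^ n)) =
          D.R * (∑ z ∈ D.nbr y, D.C y z * min 1 (v z) + ∑ z ∈ D.nbr y, D.C y z * c ^ n) := by
        rw [← Finset.sum_add_distrib, Finset.mul_sum]
        exact Finset.sum_congr rfl fun z _ => by ring
      rw [hsplit]
      exact mul_le_mul_of_nonneg_left (add_le_add hmin hpow) D.R_nonneg
    · rw [D.phi_apply_of_not_mem hy, iterate_phi_apply_of_not_mem D _ hy]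
      have h1 : 1 ≤ min 1 (v y) := le_min le_rfl (hv1 y hy)
      have h2 : 0 ≤ c ^ (n + 1) := pow_nonneg hc0 _
      nlinarith [D.R_nonneg]

variable {D} {E₁ E₂ : ((V → S) → ℝ) → ℝ}

/-- **Dobrushin's comparison estimate with a supersolution** (matrix form of Föllmer 1988, Ch. I, Comparison Theorem (2.8)
with Remark (2.17)): for two invariant states of the dusting data with row sums `≤ c ≤ 1` on `W`, every supersolution `v`
(`v ≥ 0`, `v ≥ 1` off `W`, `Cv ≤ v` on `W`) and every `n`, an admissible `f` with dependence set `Δ` and Lipschitz bound `δ`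
vanishing off `Δ` satisfies `|E₁ f − E₂ f| ≤ R ∑_{y ∈ Δ} (min 1 v(y) + c^n) δ(y)`.  The tree's profile form
`abs_sub_le_sum_pow_profile` is the case `v = c^ℓ`. [cite: Follmer1988, Ch. I Comparison Theorem (2.8)] -/
theorem abs_sub_le_of_supersolution (h₁ : D.IsInvariantState E₁) (h₂ : D.IsInvariantState E₂) {c : ℝ}
    (hc0 : 0 ≤ c) (hc1 : c ≤ 1) (hrow : ∀ x ∈ D.W, ∑ y ∈ D.nbr x, D.C x y ≤ c) {v : V → ℝ}
    (hv0 : ∀ y, 0 ≤ v y) (hv1 : ∀ y ∉ D.W, 1 ≤ v y) (hv : ∀ y ∈ D.W, D.rowC v y ≤ v y)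
    {f : (V → S) → ℝ} {Δ : Finset V} {δ : V → ℝ} (hf : D.P f Δ) (hδ : IsLipBound D.r f δ)
    (hδ0 : ∀ y ∉ Δ, δ y = 0) (n : ℕ) :
    |E₁ f - E₂ f| ≤ D.R * ∑ y ∈ Δ, (min 1 (v y) + c ^ n) * δ y := by
  obtain ⟨hest, -⟩ := DustingData.isEstimate_iterate_phi h₁ h₂ n
  refine (hest hf hδ hδ0).trans ?_
  rw [Finset.mul_sum]
  refine Finset.sum_le_sum fun y _ => ?_
  rw [← mul_assoc]
  exact mul_le_mul_of_nonneg_right (iterate_phi_le_of_supersolution D hc0 hc1 hrow hv0 hv1 hv n y) (hδ.nonneg y)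

end Abstract

/-! ### Gibbs measures: the covariance estimate with a supersolution -/

section Covariance

variable [MeasurableSpace S] {γ : Specification V S} {r : S → S → ℝ} {nbr : V → Finset V} {C : V → V → ℝ}

/-- The row action of the dusting data of a specification is `∑_{y ∈ nbr x} C x y · a y`. [folklore] -/
theorem rowC_krDustingData (hγ : IsSpecification γ) (hC : IsKRContraction γ r nbr C) {R : ℝ}
    (hr0 : ∀ a b, 0 ≤ r a b) (hrR : ∀ a b, r a b ≤ R) (hR : 0 ≤ R) (W : Set V) (a : V → ℝ) (x : V) :
    (krDustingData hγ hC hr0 hrR hR W).rowC a x = ∑ y ∈ nbr x, C x y * a y := by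
  change ∑ y ∈ nbr x, (if y ∈ nbr x then C x y else 0) * a y = _
  exact Finset.sum_congr rfl fun y hy => by rw [if_pos hy]

/-- **Covariance estimate in Dobrushin's regime with a supersolution** (matrix form of Föllmer 1988, Ch. I, Thm (2.13):
`|cov_μ(f,g)| ≤ σ² ∑ δ_i(f) D_{ki} δ_k(g)`, `D = ∑ Cⁿ`; Künsch 1982): let `γ` satisfy Dobrushin's condition in the
Vasserstein form for a weight `0 ≤ r ≤ R` with row sums `≤ c ≤ 1`, `μ` a Gibbs measure, `f, g` bounded measurable local
observables with Lipschitz bounds `δ_f, δ_g` and dependence sets `Δ_f, Δ_g`, and `v ≥ 0` a SUPERSOLUTION relative to `Δ_g`: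
`v ≥ 1` on `Δ_g` and `∑_{y ∈ nbr x} C x y · v y ≤ v x` for `x ∉ Δ_g`.  Then for every `n`,
`|cov_μ(f,g)| ≤ 2R² (∑_{y ∈ Δ_g} δ_g y) ∑_{y ∈ Δ_f} (min 1 v(y) + c^n) δ_f y`.
Proof: verbatim the tree's `abs_covariance_le_of_isKRContraction` (tilt by `g̃`, invariant state off `Δ_g`) with
`abs_sub_le_of_supersolution` as the comparison step. [cite: Follmer1988, Ch. I Theorem (2.13)] -/
theorem abs_covariance_le_of_supersolution (hγ : IsSpecification γ)
    (hC : IsKRContraction γ r nbr C) {R : ℝ} (hr0 : ∀ a b, 0 ≤ r a b) (hrR : ∀ a b, r a b ≤ R)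
    (hR : 0 ≤ R) {c : ℝ} (hc0 : 0 ≤ c) (hc1 : c ≤ 1) (hrow : ∀ x, ∑ y ∈ nbr x, C x y ≤ c)
    {μ : Measure (V → S)} (hμ : IsGibbsMeasure γ μ) {f g : (V → S) → ℝ} (hfm : Measurable f)
    {Δf : Finset V} (hfdep : DependsOn f (↑Δf : Set V)) {Mf : ℝ} (hMf : ∀ σ, |f σ| ≤ Mf)
    {δf : V → ℝ} (hδf : IsLipBound r f δf) (hgm : Measurable g) {Δg : Finset V}
    (hgdep : DependsOn g (↑Δg : Set V)) {Mg : ℝ} (hMg : ∀ σ, |g σ| ≤ Mg) {δg : V → ℝ}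
    (hδg : IsLipBound r g δg) {v : V → ℝ} (hv0 : ∀ y, 0 ≤ v y) (hv1 : ∀ y ∈ Δg, 1 ≤ v y)
    (hv : ∀ x ∉ Δg, ∑ y ∈ nbr x, C x y * v y ≤ v x) (n : ℕ) :
    |cov[f, g; μ]| ≤ 2 * R ^ 2 * (∑ y ∈ Δg, δg y) * ∑ y ∈ Δf, (min 1 (v y) + c ^ n) * δf y := by
  haveI := hμ.isProbabilityMeasure
  obtain ⟨τ₀, -⟩ := nonempty_of_measure_ne_zero (μ := μ) (s := Set.univ) (by simp)
  -- the shifted density `g̃ ∈ [0, 2 S_g]`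
  set Sg : ℝ := R * ∑ y ∈ Δg, δg y with hSg
  have hSg0 : 0 ≤ Sg := mul_nonneg hR (Finset.sum_nonneg fun y _ => hδg.nonneg y)
  set gt : (V → S) → ℝ := fun σ => g σ + (Sg - g τ₀) with hgt
  have hosc : ∀ σ, |g σ - g τ₀| ≤ Sg := fun σ =>
    abs_sub_le_mul_sum_of_dependsOn hrR hgdep hδg σ τ₀
  have hgt0 : ∀ σ, 0 ≤ gt σ := fun σ => by
    have := (abs_le.1 (hosc σ)).1; simp only [hgt]; linarith
  have hgtB : ∀ σ, gt σ ≤ 2 * Sg := fun σ => by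
    have := (abs_le.1 (hosc σ)).2; simp only [hgt]; linarith
  have hgtm : Measurable gt := hgm.add_const _
  have hgtdep : DependsOn gt (↑Δg : Set V) := fun σ τ h => by
    simp only [hgt]; rw [hgdep h]
  have hgi : Integrable g μ := integrable_of_abs_le' hgm hMg
  have hfi : Integrable f μ := integrable_of_abs_le' hfm hMf
  have hgtabs : ∀ σ, |gt σ| ≤ 2 * Sg := fun σ => by
    rw [abs_of_nonneg (hgt0 σ)]; exact hgtB σ
  have hgti : Integrable gt μ := integrable_of_abs_le' hgtm hgtabs
  -- the right-hand side is nonnegative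
  have hterm : ∀ y, 0 ≤ (min 1 (v y) + c ^ n) * δf y := fun y =>
    mul_nonneg (add_nonneg (le_min zero_le_one (hv0 y)) (pow_nonneg hc0 n)) (hδf.nonneg y)
  have hRHS : 0 ≤ 2 * R ^ 2 * (∑ y ∈ Δg, δg y) * ∑ y ∈ Δf, (min 1 (v y) + c ^ n) * δf y := by
    have h1 : 0 ≤ ∑ y ∈ Δg, δg y := Finset.sum_nonneg fun y _ => hδg.nonneg y
    have h2 : 0 ≤ ∑ y ∈ Δf, (min 1 (v y) + c ^ n) * δf y := Finset.sum_nonneg fun y _ => hterm y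
    positivity
  -- `cov(f, g) = cov(f, g̃) = μ(f g̃) - μ(f) μ(g̃)`
  have hcov : cov[f, g; μ] = ∫ σ, f σ * gt σ ∂μ - (∫ σ, f σ ∂μ) * ∫ σ, gt σ ∂μ := by
    have h1 : cov[f, g; μ] = cov[f, gt; μ] := by
      rw [hgt, covariance_add_const_right hgi]
    rw [h1, covariance_eq_sub]
    · rfl
    · exact memLp_of_bounded (a := -Mf) (b := Mf)
        (ae_of_all _ fun σ => abs_le.1 (hMf σ)) hfm.aestronglyMeasurable 2
    · exact memLp_of_bounded (a := -(2 * Sg)) (b := 2 * Sg)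
        (ae_of_all _ fun σ => abs_le.1 (hgtabs σ)) hgtm.aestronglyMeasurable 2
  by_cases hz : ∫ σ, gt σ ∂μ = 0
  · -- degenerate case: `g̃ = 0` a.e., so the covariance vanishes
    have hae : gt =ᵐ[μ] 0 := (integral_eq_zero_iff_of_nonneg (fun σ => hgt0 σ) hgti).1 hz
    have hfg : ∫ σ, f σ * gt σ ∂μ = 0 := by
      rw [← integral_zero (α := V → S) (μ := μ) (G := ℝ)]
      refine integral_congr_ae ?_
      filter_upwards [hae] with σ hσ
      simp [hσ]
    rw [hcov, hfg, hz, mul_zero, sub_zero, abs_zero]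
    exact hRHS
  have hpos : 0 < ∫ σ, gt σ ∂μ :=
    lt_of_le_of_ne (integral_nonneg hgt0) (Ne.symm hz)
  -- the comparison estimate between `μ` and its tilt by `g̃`, with the supersolution `v`
  let D := krDustingData hγ hC hr0 hrR hR ((↑Δg : Set V)ᶜ)
  have h₁ := isInvariantState_integral_of_isGibbsMeasure hγ hC hr0 hrR hR ((↑Δg : Set V)ᶜ) hμ
  have h₂ := isInvariantState_tilt hγ hC hr0 hrR hR hμ hgtm hgtdep hgt0 hgtB hpos
  have hδf' := hδf.restrict hfdep
  have hvW : ∀ y ∉ D.W, 1 ≤ v y := fun y hy => hv1 y (by simpa [D, krDustingData] using hy)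
  have hvC : ∀ y ∈ D.W, D.rowC v y ≤ v y := fun y hy => by
    rw [rowC_krDustingData hγ hC hr0 hrR hR]
    exact hv y (fun h' => (Set.mem_compl_iff _ _).1 hy (Finset.mem_coe.2 h'))
  have key := abs_sub_le_of_supersolution (D := D) h₁ h₂ hc0 hc1
    (fun x _ => (sum_krDustingData_C hγ hC hr0 hrR hR _ x).le.trans (hrow x)) hv0 hvW hvC
    (f := f) (Δ := Δf) ⟨hfm, hfdep, Mf, hMf⟩ hδf' (fun y hy => if_neg hy) n
  -- unfold the two states in `key`
  have hsum : ∑ y ∈ Δf, (min 1 (v y) + c ^ n) * (if y ∈ Δf then δf y else 0) =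
      ∑ y ∈ Δf, (min 1 (v y) + c ^ n) * δf y :=
    Finset.sum_congr rfl fun y hy => by rw [if_pos hy]
  have key' : |∫ σ, f σ ∂μ - (∫ σ, gt σ * f σ ∂μ) / ∫ σ, gt σ ∂μ| ≤
      R * ∑ y ∈ Δf, (min 1 (v y) + c ^ n) * δf y := by
    rw [← hsum]; exact key
  -- `cov = μ(g̃) · (μ_{g̃}(f) - μ(f))`
  have hfgt : ∫ σ, f σ * gt σ ∂μ = ∫ σ, gt σ * f σ ∂μ :=
    integral_congr_ae (ae_of_all _ fun σ => mul_comm _ _)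
  have hident : cov[f, g; μ] =
      (∫ σ, gt σ ∂μ) * ((∫ σ, gt σ * f σ ∂μ) / ∫ σ, gt σ ∂μ - ∫ σ, f σ ∂μ) := by
    rw [hcov, hfgt, mul_sub, mul_div_cancel₀ _ hz]
    ring
  rw [hident, abs_mul, abs_of_pos hpos, abs_sub_comm]
  have hgtint : ∫ σ, gt σ ∂μ ≤ 2 * Sg := by
    calc ∫ σ, gt σ ∂μ ≤ ∫ _σ, 2 * Sg ∂μ := integral_mono hgti (integrable_const _) hgtB
      _ = 2 * Sg := by simp
  have hsum0 : 0 ≤ ∑ y ∈ Δf, (min 1 (v y) + c ^ n) * δf y := Finset.sum_nonneg fun y _ => hterm y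
  calc (∫ σ, gt σ ∂μ) * |∫ σ, f σ ∂μ - (∫ σ, gt σ * f σ ∂μ) / ∫ σ, gt σ ∂μ|
      ≤ (2 * Sg) * (R * ∑ y ∈ Δf, (min 1 (v y) + c ^ n) * δf y) :=
        mul_le_mul hgtint key' (abs_nonneg _) (by positivity)
    _ = 2 * R ^ 2 * (∑ y ∈ Δg, δg y) * ∑ y ∈ Δf, (min 1 (v y) + c ^ n) * δf y := by
        rw [hSg]; ring

/-- **Covariance estimate with a supersolution, strict contraction** (`c < 1`, `n → ∞` in
`abs_covariance_le_of_supersolution`): `|cov_μ(f,g)| ≤ 2R² (∑ δ_g) ∑_{y ∈ Δ_f} min 1 v(y) · δ_f y`.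
[cite: Follmer1988, Ch. I Theorem (2.13)] -/
theorem abs_covariance_le_of_supersolution_of_lt_one (hγ : IsSpecification γ)
    (hC : IsKRContraction γ r nbr C) {R : ℝ} (hr0 : ∀ a b, 0 ≤ r a b) (hrR : ∀ a b, r a b ≤ R)
    (hR : 0 ≤ R) {c : ℝ} (hc0 : 0 ≤ c) (hc1 : c < 1) (hrow : ∀ x, ∑ y ∈ nbr x, C x y ≤ c)
    {μ : Measure (V → S)} (hμ : IsGibbsMeasure γ μ) {f g : (V → S) → ℝ} (hfm : Measurable f)
    {Δf : Finset V} (hfdep : DependsOn f (↑Δf : Set V)) {Mf : ℝ} (hMf : ∀ σ, |f σ| ≤ Mf)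
    {δf : V → ℝ} (hδf : IsLipBound r f δf) (hgm : Measurable g) {Δg : Finset V}
    (hgdep : DependsOn g (↑Δg : Set V)) {Mg : ℝ} (hMg : ∀ σ, |g σ| ≤ Mg) {δg : V → ℝ}
    (hδg : IsLipBound r g δg) {v : V → ℝ} (hv0 : ∀ y, 0 ≤ v y) (hv1 : ∀ y ∈ Δg, 1 ≤ v y)
    (hv : ∀ x ∉ Δg, ∑ y ∈ nbr x, C x y * v y ≤ v x) :
    |cov[f, g; μ]| ≤ 2 * R ^ 2 * (∑ y ∈ Δg, δg y) * ∑ y ∈ Δf, min 1 (v y) * δf y := by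
  have hb : ∀ n : ℕ, |cov[f, g; μ]| ≤
      2 * R ^ 2 * (∑ y ∈ Δg, δg y) * ∑ y ∈ Δf, (min 1 (v y) + c ^ n) * δf y := fun n =>
    abs_covariance_le_of_supersolution hγ hC hr0 hrR hR hc0 hc1.le hrow hμ hfm hfdep hMf hδf hgm hgdep hMg
      hδg hv0 hv1 hv n
  have hlim : Tendsto (fun n : ℕ => 2 * R ^ 2 * (∑ y ∈ Δg, δg y) * ∑ y ∈ Δf, (min 1 (v y) + c ^ n) * δf y)
      atTop (𝓝 (2 * R ^ 2 * (∑ y ∈ Δg, δg y) * ∑ y ∈ Δf, (min 1 (v y) + 0) * δf y)) := by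
    refine Tendsto.const_mul _ (tendsto_finsetSum _ fun y _ => ?_)
    exact ((tendsto_const_nhds.add (tendsto_pow_atTop_nhds_zero_of_lt_one hc0 hc1)).mul tendsto_const_nhds)
  simp only [add_zero] at hlim
  exact ge_of_tendsto' hlim hb

end Covariance

end Summit.Ventures.YMGap.RobustBall.DobrushinSupersolution

end
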